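import Mathlib
import HarnessLib
import Summits.HubbardSuperconductivity.HubbardSuperconductivity.Theorems.KLProgrammeH10TwoPointLimitSectorMultiplierSupport
import Summits.HubbardSuperconductivity.HubbardSuperconductivity.Theorems.KLProgrammeH10TwoPointLimitCharSumRates

/-!
# Route `KLProgramme` — engine support, route (L2): the `ℓ¹` size of the space-time character sum of the two-multiplier symbol
# `F_{ω₁}F_{ω₂}` of `klAnisoFamily` pairs on an admissible frame — the COMPOSITION of the symbol layer with the master lemma

Cell `gate-hubbard-kl`, seat p4 (C5a lead), g6; HOME/prover-p4/L2-SYMBOL-LAYER.md §2 (recipe).  **`charSum_klAnisoPair_le`**: for scales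
`n₂ ≤ n₁`, sectors `ω₁, ω₂`, an admissible frame, the nearly tangent integer step `v = round(2^{n₁} τ̂)` at the cell's Fermi point and any
admissible `R₀`, `Σ_z ‖Σ_q χ_{q₁}(z₁)χ_{q₂}(z₂) F_{ω₁}(k q)F_{ω₂}(k q)‖` is bounded by `sum_norm_charSum_le_of_consts` fed with the explicit
constants `K_t` (`norm_fwdDiff_two_time_klAnisoPair_le`), `K₁` (axes), `K₂` (`v⊥`), `K₃` (`v`) (`norm_fwdDiff_two_space_klAnisoPair_le`,
tangency data `abs_fderiv_frameBand_apply_le` / `tangentStep_bounds`) and the support count `card_support_klAnisoPair_le`.  Dividing by `βL²`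
(`overlapKernel_sums_le_of_charSum_le`) gives the overlap size `B` of BGM (2.71a) for this pair; `hrow′ ≤ 9B`, `hcol′ ≤ 9·2^Δ B` then follow from
`rowSum_/colSum_sectorAnalysis_mul_sectorSub_le`.  Everything is proved; no definitions, no named facts. [folklore]
-/

noncomputable section

namespace Summit.HubbardSuperconductivity.HubbardSuperconductivity.Theorems.TorusFourierL2

set_option linter.dupNamespace false -- summit = problem name (single-conjunct summit), D-0017

open Set Finset Literature.MathematicalPhysics.QuantumLattice Literature.MathematicalPhysics.QuantumLattice.BandSectorCounting
open Literature.MathematicalPhysics.QuantumLattice.FermiRG Literature.Probability.LatticeModels Literature.Analysis.SpecialFunctions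
open Summit.HubbardSuperconductivity.HubbardSuperconductivity.Theorems.DispersionFlow
open Summit.HubbardSuperconductivity.HubbardSuperconductivity.Theorems.KLRegimeSplit
open Summit.HubbardSuperconductivity.HubbardSuperconductivity.Theorems.KLProgrammeLegKernels
open Summit.HubbardSuperconductivity.HubbardSuperconductivity.Theorems.PerturbedFermiCurve
open scoped Real

/-- The sup norm and the complex modulus of the axis step `(2π/L)eᵢ` are `2π/L`. [folklore] -/
theorem norms_axisStep (L : ℕ) [NeZero L] (i : Fin 2) :
    ‖(fun j : Fin 2 => 2 * π / L * (((Pi.single i (1 : ℤ) : Fin 2 → ℤ) j : ℤ) : ℝ))‖ = 2 * π / L ∧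
      ‖momToComplex (fun j : Fin 2 => 2 * π / L * (((Pi.single i (1 : ℤ) : Fin 2 → ℤ) j : ℤ) : ℝ))‖ = 2 * π / L := by
  have hL : (0 : ℝ) < L := Nat.cast_pos.2 (Nat.pos_of_ne_zero (NeZero.ne L))
  have hc : 0 < 2 * π / (L : ℝ) := by positivity
  have hfun : (fun j : Fin 2 => 2 * π / L * (((Pi.single i (1 : ℤ) : Fin 2 → ℤ) j : ℤ) : ℝ)) = Pi.single i (2 * π / L) := by
    funext j
    by_cases hj : j = i
    · subst hj; simp
    · simp [hj]
  rw [hfun, Pi.norm_single, Real.norm_eq_abs, abs_of_pos hc]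
  refine ⟨rfl, ?_⟩
  have hsq := norm_momToComplex_sq (Pi.single i (2 * π / (L : ℝ)) : Fin 2 → ℝ)
  have hval : (Pi.single i (2 * π / (L : ℝ)) : Fin 2 → ℝ) 0 ^ 2 + (Pi.single i (2 * π / (L : ℝ)) : Fin 2 → ℝ) 1 ^ 2 = (2 * π / L) ^ 2 := by
    fin_cases i <;> simp
  rw [hval] at hsq
  exact (sq_eq_sq₀ (norm_nonneg _) hc.le).1 hsq

/-- The axis step as an element of `(ℤ/Lℤ)²` is `Pi.single i 1`. [folklore] -/
theorem axisStep_cast (L : ℕ) (i : Fin 2) :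
    (fun j : Fin 2 => (((Pi.single i (1 : ℤ) : Fin 2 → ℤ) j : ℤ) : ZMod L)) = Pi.single i (1 : ZMod L) := by
  funext j
  by_cases hj : j = i
  · subst hj; simp
  · simp [hj]

/-- A nonzero integer step has sup norm `≥ 2π/L`: `‖(2π/L)u‖ ≥ 2π/L` for `u ≠ 0`. [folklore] -/
theorem norm_step_ge (L : ℕ) [NeZero L] {u : Fin 2 → ℤ} (hu : u ≠ 0) :
    2 * π / L ≤ ‖(fun j : Fin 2 => 2 * π / L * (u j : ℝ))‖ := by
  have hL : (0 : ℝ) < L := Nat.cast_pos.2 (Nat.pos_of_ne_zero (NeZero.ne L))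
  obtain ⟨j, hj⟩ : ∃ j, u j ≠ 0 := by
    by_contra h; push Not at h; exact hu (funext h)
  have h1 : (1 : ℝ) ≤ |(u j : ℝ)| := by exact_mod_cast Int.one_le_abs hj
  calc 2 * π / L ≤ 2 * π / L * |(u j : ℝ)| := le_mul_of_one_le_right (by positivity) h1
    _ = |2 * π / L * (u j : ℝ)| := by rw [abs_mul, abs_of_pos (by positivity : (0 : ℝ) < 2 * π / L)]
    _ = ‖(fun j : Fin 2 => 2 * π / L * (u j : ℝ)) j‖ := (Real.norm_eq_abs _).symm
    _ ≤ _ := norm_le_pi_norm (fun j : Fin 2 => 2 * π / L * (u j : ℝ)) j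


section Main

variable {L M : ℕ} [NeZero L] [NeZero M] {a b : ℝ} (B : BandBounds a b) {K : TrigPolyC4v} {A : ℝ}
  (hA : ∀ p : Momentum, ∀ j ≤ 2, ‖iteratedFDeriv ℝ j (frameShift K) p‖ ≤ A) (hADt : 2 * A < B.Dtmin)
  {μ e₀ z β : ℝ} (he : 0 < e₀) (hz : 0 < z) (hz1 : z ≤ 1) (hgap : e₀ + A + z ^ 2 < -μ) (h3 : e₀ + A - μ ≤ 3)
  (hlo : a ≤ μ - A - e₀) (hhi : μ + A + e₀ ≤ b) (hβ : 0 < β) (hρA : 4 * A < 2 * B.rhomin)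
  {n₁ n₂ : ℕ} (hn : n₂ ≤ n₁) (ω₁ : Fin (sectorCount n₁)) (ω₂ : Fin (sectorCount n₂))
  {d : ℝ} (hd : 0 < d) (hd1 : ∀ u, |deriv (bgmCutoffSq e₀) u| ≤ d) (hd2 : ∀ u, |iteratedDeriv 2 (bgmCutoffSq e₀) u| ≤ d)
  {Z : (Fin 2 → ℝ) → ℝ}
  (hZ : ∀ p, Z p = gnCutoff ((π + z) ^ 2 / π ^ 2) ((π + z) ^ 2) (p 0 ^ 2) * gnCutoff ((π + z) ^ 2 / π ^ 2) ((π + z) ^ 2) (p 1 ^ 2) *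
    ((radialCutoffC (1 / 2) (momToComplex p) * sectorWeightCirc n₁ ((ω₁ : ℕ) : ℤ) (polarAngle p)) *
      (radialCutoffC (1 / 2) (momToComplex p) * sectorWeightCirc n₂ ((ω₂ : ℕ) : ℤ) (polarAngle p))))
  {Φ : ℝ × (Fin 2 → ℝ) → ℂ}
  (hΦ : ∀ k₀ p, Φ (k₀, p) = ((bgmCutoffSq e₀ ((16 : ℝ) ^ n₁ * (k₀ ^ 2 + frameLevel μ K (WithLp.toLp 2 p) ^ 2)) *
      bgmCutoffSq e₀ ((16 : ℝ) ^ n₂ * (k₀ ^ 2 + frameLevel μ K (WithLp.toLp 2 p) ^ 2)) * Z p : ℝ) : ℂ))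
  {Gs : TorusSite 1 (2 * M) × TorusSite 2 L → ℂ}
  (hGs : ∀ q, Gs q = klAnisoFamily L M β μ K e₀ n₁ ω₁ (⟨(q.1 0).val, ZMod.val_lt (q.1 0)⟩, q.2) *
    klAnisoFamily L M β μ K e₀ n₂ ω₂ (⟨(q.1 0).val, ZMod.val_lt (q.1 0)⟩, q.2))

set_option maxHeartbeats 800000 in -- a 40-line explicit constant: elaboration of the statement and `gcongr` are slow
include B hA hADt he hz hz1 hgap h3 hlo hhi hβ hρA hn hd hd1 hd2 hZ hΦ hGs in
/-- **The `ℓ¹` size of the space-time character sum of `F_{ω₁}F_{ω₂}` on an admissible frame** (the numerator of the overlap size `B` of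
BGM (2.71a) for this pair: divide by `βL²`, `overlapKernel_sums_le_of_charSum_le`).  Data: `v` the rounding of `2^{n₁}τ̂` at the cell's Fermi
point (`hv0`, `hv1`), `R₀` admissible, `(4π/L)(2^{n₁} + ½) ≤ z`, `Λ_{n₁}β < π(2M − 3)`, `B_a > 0` the angular constant.
[cite: BenfattoGiulianiMastropietro2006, §2.6 (2.81), §2.7 (2.71a)] -/
theorem charSum_klAnisoPair_le (hM : klScale e₀ n₁ * β < π * (2 * M - 3)) {Ba : ℝ} (hB0 : 0 < Ba)
    (hB : ∀ (i : ℕ), i ≤ 2 → ∀ (n : ℕ) (ω : ℤ) (θ₀ : ℝ) (q w : Fin 2 → ℝ) (t : ℝ) {r₀ : ℝ}, 0 < r₀ →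
      r₀ ≤ ‖momToComplex (q + t • w)‖ → |sectorRelAngle θ₀ (q + t • w)| < π →
      ‖iteratedDeriv i (fun t : ℝ => sectorWeightCirc n ω (polarAngle (q + t • w))) t‖ ≤
        (2 : ℕ).factorial * Ba * ((1 + (sectorWidth n)⁻¹ * (2 : ℕ).factorial) * ‖momToComplex w‖ / r₀) ^ i)
    (hLz : 2 * |2 * π / (L : ℝ)| * ((2 : ℝ) ^ n₁ + 1 / 2) ≤ z) (v : Fin 2 → ℤ)
    (hv0 : v 0 = round ((2 : ℝ) ^ n₁ *
      (-fderiv ℝ (fun p : Fin 2 → ℝ => frameLevel μ K (WithLp.toLp 2 p)) (klFermiPoint μ K (sectorCenter n₂ (ω₂ : ℕ))) (Pi.single 1 1) /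
        Real.sqrt (fderiv ℝ (fun p : Fin 2 → ℝ => frameLevel μ K (WithLp.toLp 2 p)) (klFermiPoint μ K (sectorCenter n₂ (ω₂ : ℕ))) (Pi.single 0 1) ^ 2 +
          fderiv ℝ (fun p : Fin 2 → ℝ => frameLevel μ K (WithLp.toLp 2 p)) (klFermiPoint μ K (sectorCenter n₂ (ω₂ : ℕ))) (Pi.single 1 1) ^ 2))))
    (hv1 : v 1 = round ((2 : ℝ) ^ n₁ *
      (fderiv ℝ (fun p : Fin 2 → ℝ => frameLevel μ K (WithLp.toLp 2 p)) (klFermiPoint μ K (sectorCenter n₂ (ω₂ : ℕ))) (Pi.single 0 1) /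
        Real.sqrt (fderiv ℝ (fun p : Fin 2 → ℝ => frameLevel μ K (WithLp.toLp 2 p)) (klFermiPoint μ K (sectorCenter n₂ (ω₂ : ℕ))) (Pi.single 0 1) ^ 2 +
          fderiv ℝ (fun p : Fin 2 → ℝ => frameLevel μ K (WithLp.toLp 2 p)) (klFermiPoint μ K (sectorCenter n₂ (ω₂ : ℕ))) (Pi.single 1 1) ^ 2))))
    {R₀ : ℕ} (hR₀ : 2 * (|v 0| + |v 1|) * (R₀ : ℤ) < L) :
    ∑ z : TorusSite 1 (2 * M) × TorusSite 2 L,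
        ‖∑ q : TorusSite 1 (2 * M) × TorusSite 2 L, (torusChar q.1 z.1 * torusChar q.2 z.2) • Gs q‖ ≤
      Real.sqrt (2048 * (1 / (4 * Real.sqrt (1 / ((4 * (d * e₀ ^ 4 * 1 + 2 * (d * e₀ ^ 2) * (d * e₀ ^ 2) + 1 * (d * e₀ ^ 4)) + 2 * (d * e₀ ^ 2 * 1 + 1 * (d * e₀ ^ 2))) * (2 * π / β) ^ 2 * 1 / klScale e₀ n₁ ^ 2)) / ((2 * M : ℕ) : ℝ)) + 1) *
          (4 * ((2 * Real.sqrt 2 / (4 * Real.sqrt (1 / (((4 * (d * e₀ ^ 4 * 1 + 2 * (d * e₀ ^ 2) * (d * e₀ ^ 2) + 1 * (d * e₀ ^ 4)) + 2 * (d * e₀ ^ 2 * 1 + 1 * (d * e₀ ^ 2))) * (((4 + 2 * A) * ‖(fun j : Fin 2 => 2 * π / L * (((![-v 1, v 0] : Fin 2 → ℤ) j : ℤ) : ℝ))‖) + (4 + 4 * A) * (((klScale e₀ n₁ + B.smax * B.Dtmin * (3 * sectorWidth n₂ / 4)) / (B.Dtmin - 2 * A)) + 2 * ‖(fun j : Fin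 2 => 2 * π / L * (((![-v 1, v 0] : Fin 2 → ℤ) j : ℤ) : ℝ))‖) * ‖(fun j : Fin 2 => 2 * π / L * (((![-v 1, v 0] : Fin 2 → ℤ) j : ℤ) : ℝ))‖) ^ 2 / klScale e₀ n₁ ^ 2 + 2 * (d * e₀ ^ 2 * 1 + 1 * (d * e₀ ^ 2)) * ((4 + 4 * A) * ‖(fun j : Fin 2 => 2 * π / L * (((![-v 1, v 0] : Fin 2 → ℤ) j : ℤ) : ℝ))‖ ^ 2) / klScale e₀ n₁) * 1 + 4 * (d * e₀ ^ 2 * 1 + 1 * (d * e₀ ^ 2)) * (((4 + 2 * A) * ‖(fun j : Fin 2 => 2 * π / L * (((![-v 1, v 0] : Fin 2 → ℤ) j : ℤ) : ℝ))‖) + (4 + 4 * A) * (((klScale e₀ n₁ + B.smax * B.Dtmin * (3 * sectorWidth n₂ / 4)) / (B.Dtmin - 2 * A)) + 2 * ‖(fun j : Fin 2 => 2 * π / L * (((![-v 1, v 0] : Fin 2 → ℤ) j : ℤ) : ℝ))‖) * ‖(fun j : Fin 2 => 2 * π / L * (((![-v 1, v 0] : Fin 2 → ℤ) j : ℤ)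 : ℝ))‖) / klScale e₀ n₁ * (2 * Ba * (((1 + 2 * (sectorWidth n₁)⁻¹) * ‖momToComplex (fun j : Fin 2 => 2 * π / L * (((![-v 1, v 0] : Fin 2 → ℤ) j : ℤ) : ℝ))‖) + ((1 + 2 * (sectorWidth n₂)⁻¹) * ‖momToComplex (fun j : Fin 2 => 2 * π / L * (((![-v 1, v 0] : Fin 2 → ℤ) j : ℤ) : ℝ))‖))) + 1 * 1 * (2 * Ba * (((1 + 2 * (sectorWidth n₁)⁻¹) * ‖momToComplex (fun j : Fin 2 => 2 * π / L * (((![-v 1, v 0] : Fin 2 → ℤ) j : ℤ) : ℝ))‖) ^ 2 + ((1 + 2 * (sectorWidth n₂)⁻¹) * ‖momToComplex (fun j : Fin 2 => 2 * π / L * (((![-v 1, v 0] : Fin 2 → ℤ) j : ℤ) : ℝ))‖) ^ 2) + 8 * Ba ^ 2 * (((1 + 2 * (sectorWidth n₁)⁻¹) * ‖momToComplex (fun j : Fin 2 => 2 * π / L * (((![-v 1, v 0] : Fin 2 → ℤ) j : ℤ) : ℝ))‖) * ((1 + 2 * (sectorWidth n₂)⁻¹) * ‖momToComplex (fun j : Fin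 2 => 2 * π / L * (((![-v 1, v 0] : Fin 2 → ℤ) j : ℤ) : ℝ))‖))))) / L * Real.sqrt ((v 0 : ℝ) ^ 2 + (v 1 : ℝ) ^ 2)) + 2) *
              (2 * Real.sqrt 2 / (4 * Real.sqrt (1 / (((4 * (d * e₀ ^ 4 * 1 + 2 * (d * e₀ ^ 2) * (d * e₀ ^ 2) + 1 * (d * e₀ ^ 4)) + 2 * (d * e₀ ^ 2 * 1 + 1 * (d * e₀ ^ 2))) * ((|2 * π / (L : ℝ)| * (4 + 2 * A)) + (4 + 4 * A) * (((klScale e₀ n₁ + B.smax * B.Dtmin * (3 * sectorWidth n₂ / 4)) / (B.Dtmin - 2 * A)) + 2 * ‖(fun j : Fin 2 => 2 * π / L * (v j : ℝ))‖) * ‖(fun j : Fin 2 => 2 * π / L * (v j : ℝ))‖) ^ 2 / klScale e₀ n₁ ^ 2 + 2 * (d * e₀ ^ 2 * 1 + 1 * (d * e₀ ^ 2)) * ((4 + 4 * A) * ‖(fun j : Fin 2 => 2 * π / L * (v j : ℝ))‖ ^ 2) / klScale e₀ n₁) * 1 + 4 * (d * e₀ ^ 2 * 1 + 1 * (d * e₀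 ^ 2)) * ((|2 * π / (L : ℝ)| * (4 + 2 * A)) + (4 + 4 * A) * (((klScale e₀ n₁ + B.smax * B.Dtmin * (3 * sectorWidth n₂ / 4)) / (B.Dtmin - 2 * A)) + 2 * ‖(fun j : Fin 2 => 2 * π / L * (v j : ℝ))‖) * ‖(fun j : Fin 2 => 2 * π / L * (v j : ℝ))‖) / klScale e₀ n₁ * (2 * Ba * (((1 + 2 * (sectorWidth n₁)⁻¹) * ‖momToComplex (fun j : Fin 2 => 2 * π / L * (v j : ℝ))‖) + ((1 + 2 * (sectorWidth n₂)⁻¹) * ‖momToComplex (fun j : Fin 2 => 2 * π / L * (v j : ℝ))‖))) + 1 * 1 * (2 * Ba * (((1 + 2 * (sectorWidth n₁)⁻¹) * ‖momToComplex (fun j : Fin 2 => 2 * π / L * (v j : ℝ))‖) ^ 2 + ((1 + 2 * (sectorWidth n₂)⁻¹) * ‖momToComplex (fun j : Fin 2 => 2 * π / L * (v j : ℝ))‖) ^ 2) + 8 * Ba ^ 2 * (((1 + 2 * (sectorWidth n₁)⁻¹) * ‖momToComplex (fun j : Fin 2 => 2 * π / L * (v j : ℝ))‖) * ((1 + 2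 * (sectorWidth n₂)⁻¹) * ‖momToComplex (fun j : Fin 2 => 2 * π / L * (v j : ℝ))‖))))) / L * Real.sqrt ((v 0 : ℝ) ^ 2 + (v 1 : ℝ) ^ 2)) + 2))
            + 16 * (1 / (4 * Real.sqrt (1 / (((4 * (d * e₀ ^ 4 * 1 + 2 * (d * e₀ ^ 2) * (d * e₀ ^ 2) + 1 * (d * e₀ ^ 4)) + 2 * (d * e₀ ^ 2 * 1 + 1 * (d * e₀ ^ 2))) * (((4 + 2 * A) * (2 * π / L)) + (4 + 4 * A) * (((klScale e₀ n₁ + B.smax * B.Dtmin * (3 * sectorWidth n₂ / 4)) / (B.Dtmin - 2 * A)) + 2 * (2 * π / L)) * (2 * π / L)) ^ 2 / klScale e₀ n₁ ^ 2 + 2 * (d * e₀ ^ 2 * 1 + 1 * (d * e₀ ^ 2)) * ((4 + 4 * A) * (2 * π / L) ^ 2) / klScale e₀ n₁) * 1 + 4 * (d * e₀ ^ 2 * 1 + 1 * (d * e₀ ^ 2)) * (((4 + 2 * A) * (2 * π / L)) + (4 + 4 * A) * (((klScale e₀ n₁ + B.smax * B.Dtmin * (3 * sectorWidth n₂ / 4))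 / (B.Dtmin - 2 * A)) + 2 * (2 * π / L)) * (2 * π / L)) / klScale e₀ n₁ * (2 * Ba * (((1 + 2 * (sectorWidth n₁)⁻¹) * (2 * π / L)) + ((1 + 2 * (sectorWidth n₂)⁻¹) * (2 * π / L)))) + 1 * 1 * (2 * Ba * (((1 + 2 * (sectorWidth n₁)⁻¹) * (2 * π / L)) ^ 2 + ((1 + 2 * (sectorWidth n₂)⁻¹) * (2 * π / L)) ^ 2) + 8 * Ba ^ 2 * (((1 + 2 * (sectorWidth n₁)⁻¹) * (2 * π / L)) * ((1 + 2 * (sectorWidth n₂)⁻¹) * (2 * π / L)))))) / L) + 1) ^ 2 / (1 + 4 * Real.sqrt (1 / (((4 * (d * e₀ ^ 4 * 1 + 2 * (d * e₀ ^ 2) * (d * e₀ ^ 2) + 1 * (d * e₀ ^ 4)) + 2 * (d * e₀ ^ 2 * 1 + 1 * (d * e₀ ^ 2))) * (((4 + 2 * A) * (2 * π / L)) + (4 + 4 * A) * (((klScale e₀ n₁ + B.smax * B.Dtmin * (3 * sectorWidth n₂ / 4)) / (B.Dtmin - 2 * A)) + 2 * (2 * π / L)) * (2 * π / L)) ^ 2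 / klScale e₀ n₁ ^ 2 + 2 * (d * e₀ ^ 2 * 1 + 1 * (d * e₀ ^ 2)) * ((4 + 4 * A) * (2 * π / L) ^ 2) / klScale e₀ n₁) * 1 + 4 * (d * e₀ ^ 2 * 1 + 1 * (d * e₀ ^ 2)) * (((4 + 2 * A) * (2 * π / L)) + (4 + 4 * A) * (((klScale e₀ n₁ + B.smax * B.Dtmin * (3 * sectorWidth n₂ / 4)) / (B.Dtmin - 2 * A)) + 2 * (2 * π / L)) * (2 * π / L)) / klScale e₀ n₁ * (2 * Ba * (((1 + 2 * (sectorWidth n₁)⁻¹) * (2 * π / L)) + ((1 + 2 * (sectorWidth n₂)⁻¹) * (2 * π / L)))) + 1 * 1 * (2 * Ba * (((1 + 2 * (sectorWidth n₁)⁻¹) * (2 * π / L)) ^ 2 + ((1 + 2 * (sectorWidth n₂)⁻¹) * (2 * π / L)) ^ 2) + 8 * Ba ^ 2 * (((1 + 2 * (sectorWidth n₁)⁻¹) * (2 * π / L)) * ((1 + 2 * (sectorWidth n₂)⁻¹) * (2 * π / L)))))) / L * R₀))) *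
        Real.sqrt (16 * ((2 * M : ℕ) : ℝ) * (L : ℝ) ^ 2 * ((klScale e₀ n₁ * β / π + 1) * ((Real.sqrt 2 * L * ((klScale e₀ n₁ + (4 + 4 * A) * ((klScale e₀ n₁ + B.smax * B.Dtmin * (3 * sectorWidth n₂ / 4)) / (B.Dtmin - 2 * A)) ^ 2) / (2 * B.rhomin - 4 * A)) / π + 2) * (Real.sqrt 2 * L * (2 * ((klScale e₀ n₁ + B.smax * B.Dtmin * (3 * sectorWidth n₂ / 4)) / (B.Dtmin - 2 * A))) / π + 2)))) * 1 := by
  classical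
  have hL : (0 : ℝ) < L := Nat.cast_pos.2 (Nat.pos_of_ne_zero (NeZero.ne L))
  have hΛ : 0 < klScale e₀ n₁ := by rw [klScale]; positivity
  have hπ := Real.pi_pos
  have hA0 : 0 ≤ A := le_trans (norm_nonneg _) (hA 0 0 (by norm_num))
  have hlo' : a ≤ μ - A := by linarith
  have hhi' : μ + A ≤ b := by linarith
  have hc : 0 < 2 * π / (L : ℝ) := by positivity
  have hG1 : 0 < (d * e₀ ^ 2 * 1 + 1 * (d * e₀ ^ 2)) := by positivity
  have hDt : 0 < B.Dtmin - 2 * A := by linarith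
  have hρ0 : 0 ≤ ((klScale e₀ n₁ + B.smax * B.Dtmin * (3 * sectorWidth n₂ / 4)) / (B.Dtmin - 2 * A)) := by
    have := B.smax_pos; have := B.Dtmin_pos; have := sectorWidth_pos n₂; positivity
  have hw₁ : 0 < (sectorWidth n₁)⁻¹ := inv_pos.2 (sectorWidth_pos n₁)
  have hw₂ : 0 < (sectorWidth n₂)⁻¹ := inv_pos.2 (sectorWidth_pos n₂)
  set eK : (Fin 2 → ℝ) → ℝ := fun p => frameLevel μ K (WithLp.toLp 2 p) with heK
  set pF : Fin 2 → ℝ := klFermiPoint μ K (sectorCenter n₂ (ω₂ : ℕ)) with hpF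
  -- the tangent step
  have hgrad : ‖fderiv ℝ eK pF‖ ≤ 4 + 2 * A := norm_fderiv_frameBand_le hA μ pF
  have hγ : 0 < Real.sqrt (fderiv ℝ eK pF (Pi.single 0 1) ^ 2 + fderiv ℝ eK pF (Pi.single 1 1) ^ 2) :=
    lt_of_lt_of_le (by linarith) (gradient_floor_klFermiPoint B hA hlo' hhi' (sectorCenter n₂ (ω₂ : ℕ)))
  have hN : (1 : ℝ) ≤ (2 : ℝ) ^ n₁ := one_le_pow₀ (by norm_num)
  obtain ⟨hτv, hvsize, hv⟩ := tangentStep_bounds eK pF hgrad hγ hN v hv0 hv1 (2 * π / L)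
  -- admissibility of the steps
  have huv : ∀ j, 2 * |2 * π / (L : ℝ)| * |(v j : ℝ)| ≤ z := fun j =>
    (mul_le_mul_of_nonneg_left (hvsize j) (by positivity)).trans hLz
  have huax : ∀ (i j : Fin 2), 2 * |2 * π / (L : ℝ)| * |(((Pi.single i (1 : ℤ) : Fin 2 → ℤ) j : ℤ) : ℝ)| ≤ z := by
    intro i j
    have h1 : |(((Pi.single i (1 : ℤ) : Fin 2 → ℤ) j : ℤ) : ℝ)| ≤ (2 : ℝ) ^ n₁ + 1 / 2 := by
      have : |(((Pi.single i (1 : ℤ) : Fin 2 → ℤ) j : ℤ) : ℝ)| ≤ 1 := by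
        by_cases hj : j = i
        · subst hj; simp
        · simp [hj]
      linarith
    exact (mul_le_mul_of_nonneg_left h1 (by positivity)).trans hLz
  have huperp : ∀ j, 2 * |2 * π / (L : ℝ)| * |(((![-v 1, v 0] : Fin 2 → ℤ) j : ℤ) : ℝ)| ≤ z := by
    intro j
    fin_cases j
    · simpa [abs_neg] using huv 1
    · simpa using huv 0
  -- the four pointwise bounds
  have h0 := fun q => norm_fwdDiff_two_time_klAnisoPair_le hA he hz h3 hβ hn ω₁ ω₂ hd.le hd1 hd2 hZ hΦ hGs hM q
  have h1 : ∀ q (i : Fin 2), ‖((fwdDiff ((0 : TorusSite 1 (2 * M)), (Pi.single i (1 : ZMod L) : TorusSite 2 L)))^[2] Gs) q‖ ≤ (((4 * (d * e₀ ^ 4 * 1 + 2 * (d * e₀ ^ 2) * (d * e₀ ^ 2) + 1 * (d * e₀ ^ 4)) + 2 * (d * e₀ ^ 2 * 1 + 1 * (d * e₀ ^ 2))) * (((4 + 2 * A) * (2 * π / L)) + (4 + 4 * A) * (((klScale e₀ n₁ + B.smax * B.Dtmin * (3 * sectorWidth n₂ / 4)) / (B.Dtmin - 2 * A)) + 2 *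 (2 * π / L)) * (2 * π / L)) ^ 2 / klScale e₀ n₁ ^ 2 + 2 * (d * e₀ ^ 2 * 1 + 1 * (d * e₀ ^ 2)) * ((4 + 4 * A) * (2 * π / L) ^ 2) / klScale e₀ n₁) * 1 + 4 * (d * e₀ ^ 2 * 1 + 1 * (d * e₀ ^ 2)) * (((4 + 2 * A) * (2 * π / L)) + (4 + 4 * A) * (((klScale e₀ n₁ + B.smax * B.Dtmin * (3 * sectorWidth n₂ / 4)) / (B.Dtmin - 2 * A)) + 2 * (2 * π / L)) * (2 * π / L)) / klScale e₀ n₁ * (2 * Ba * (((1 + 2 * (sectorWidth n₁)⁻¹) * (2 * π / L)) + ((1 + 2 * (sectorWidth n₂)⁻¹) * (2 * π / L)))) + 1 * 1 * (2 * Ba * (((1 + 2 * (sectorWidth n₁)⁻¹) * (2 * π / L)) ^ 2 + ((1 + 2 * (sectorWidth n₂)⁻¹) * (2 * π / L)) ^ 2) + 8 * Ba ^ 2 * (((1 + 2 * (sectorWidth n₁)⁻¹) * (2 * π / L)) * ((1 + 2 * (sectorWidth n₂)⁻¹) * (2 * π / L))))) := by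
    intro q i
    have hτ : |fderiv ℝ (fun p : Fin 2 → ℝ => frameLevel μ K (WithLp.toLp 2 p)) (klFermiPoint μ K (sectorCenter n₂ (ω₂ : ℕ)))
        (fun j => 2 * π / L * (((Pi.single i (1 : ℤ) : Fin 2 → ℤ) j : ℤ) : ℝ))| ≤ (4 + 2 * A) * (2 * π / L) := by
      calc _ ≤ (4 + 2 * A) * ‖(fun j : Fin 2 => 2 * π / L * (((Pi.single i (1 : ℤ) : Fin 2 → ℤ) j : ℤ) : ℝ))‖ :=
            abs_fderiv_frameBand_apply_le hA μ _ _
        _ = (4 + 2 * A) * (2 * π / L) := by rw [(norms_axisStep L i).1]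
    have h := norm_fwdDiff_two_space_klAnisoPair_le B hA hADt he hz hz1 hgap h3 hlo hhi hn ω₁ ω₂ hd.le hd1 hd2 hZ hΦ hGs hB0.le hB
      (Pi.single i 1) (huax i) hτ q
    rw [(norms_axisStep L i).1, (norms_axisStep L i).2, axisStep_cast] at h
    exact h
  have h2 : ∀ q, ‖((fwdDiff ((0 : TorusSite 1 (2 * M)), (fun j => ((((![-v 1, v 0] : Fin 2 → ℤ) j : ℤ)) : ZMod L))))^[2] Gs) q‖ ≤ (((4 * (d * e₀ ^ 4 * 1 + 2 * (d * e₀ ^ 2) * (d * e₀ ^ 2) + 1 * (d * e₀ ^ 4)) + 2 * (d * e₀ ^ 2 * 1 + 1 * (d * e₀ ^ 2))) * (((4 + 2 * A) * ‖(fun j : Fin 2 => 2 * π / L * (((![-v 1, v 0] : Fin 2 → ℤ) j : ℤ) : ℝ))‖) + (4 + 4 * A) * (((klScale e₀ n₁ + B.smax * B.Dtmin * (3 * sectorWidth n₂ / 4)) / (B.Dtmin - 2 * A)) + 2 * ‖(fun j : Fin 2 => 2 * π / L * (((![-v 1, v 0] : Fin 2 → ℤ) j : ℤ) : ℝ))‖)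 * ‖(fun j : Fin 2 => 2 * π / L * (((![-v 1, v 0] : Fin 2 → ℤ) j : ℤ) : ℝ))‖) ^ 2 / klScale e₀ n₁ ^ 2 + 2 * (d * e₀ ^ 2 * 1 + 1 * (d * e₀ ^ 2)) * ((4 + 4 * A) * ‖(fun j : Fin 2 => 2 * π / L * (((![-v 1, v 0] : Fin 2 → ℤ) j : ℤ) : ℝ))‖ ^ 2) / klScale e₀ n₁) * 1 + 4 * (d * e₀ ^ 2 * 1 + 1 * (d * e₀ ^ 2)) * (((4 + 2 * A) * ‖(fun j : Fin 2 => 2 * π / L * (((![-v 1, v 0] : Fin 2 → ℤ) j : ℤ) : ℝ))‖) + (4 + 4 * A) * (((klScale e₀ n₁ + B.smax * B.Dtmin * (3 * sectorWidth n₂ / 4)) / (B.Dtmin - 2 * A)) + 2 * ‖(fun j : Fin 2 => 2 * π / L * (((![-v 1, v 0] : Fin 2 → ℤ) j : ℤ) : ℝ))‖) * ‖(fun j : Fin 2 => 2 * π / L * (((![-v 1, v 0] : Fin 2 → ℤ) j : ℤ) : ℝ))‖) / klScale e₀ n₁ * (2 * Ba * (((1 + 2 * (sectorWidth n₁)⁻¹)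 * ‖momToComplex (fun j : Fin 2 => 2 * π / L * (((![-v 1, v 0] : Fin 2 → ℤ) j : ℤ) : ℝ))‖) + ((1 + 2 * (sectorWidth n₂)⁻¹) * ‖momToComplex (fun j : Fin 2 => 2 * π / L * (((![-v 1, v 0] : Fin 2 → ℤ) j : ℤ) : ℝ))‖))) + 1 * 1 * (2 * Ba * (((1 + 2 * (sectorWidth n₁)⁻¹) * ‖momToComplex (fun j : Fin 2 => 2 * π / L * (((![-v 1, v 0] : Fin 2 → ℤ) j : ℤ) : ℝ))‖) ^ 2 + ((1 + 2 * (sectorWidth n₂)⁻¹) * ‖momToComplex (fun j : Fin 2 => 2 * π / L * (((![-v 1, v 0] : Fin 2 → ℤ) j : ℤ) : ℝ))‖) ^ 2) + 8 * Ba ^ 2 * (((1 + 2 * (sectorWidth n₁)⁻¹) * ‖momToComplex (fun j : Fin 2 => 2 * π / L * (((![-v 1, v 0] : Fin 2 → ℤ) j : ℤ) : ℝ))‖) * ((1 + 2 * (sectorWidth n₂)⁻¹) * ‖momToComplex (fun j : Fin 2 => 2 * π / L * (((![-v 1, v 0] : Fin 2 → ℤ) j : ℤ) : ℝ))‖))))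 :=
    fun q => norm_fwdDiff_two_space_klAnisoPair_le B hA hADt he hz hz1 hgap h3 hlo hhi hn ω₁ ω₂ hd.le hd1 hd2 hZ hΦ hGs hB0.le hB
      (![-v 1, v 0]) huperp (abs_fderiv_frameBand_apply_le hA μ _ _) q
  have h3' : ∀ q, ‖((fwdDiff ((0 : TorusSite 1 (2 * M)), (fun j => ((v j : ℤ) : ZMod L))))^[2] Gs) q‖ ≤ (((4 * (d * e₀ ^ 4 * 1 + 2 * (d * e₀ ^ 2) * (d * e₀ ^ 2) + 1 * (d * e₀ ^ 4)) + 2 * (d * e₀ ^ 2 * 1 + 1 * (d * e₀ ^ 2))) * ((|2 * π / (L : ℝ)| * (4 + 2 * A)) + (4 + 4 * A) * (((klScale e₀ n₁ + B.smax * B.Dtmin * (3 * sectorWidth n₂ / 4)) / (B.Dtmin - 2 * A)) + 2 * ‖(fun j : Fin 2 => 2 * π / L * (v j : ℝ))‖) * ‖(fun j : Fin 2 => 2 * π / L * (v j : ℝ))‖) ^ 2 / klScale e₀ n₁ ^ 2 + 2 * (d * e₀ ^ 2 * 1 + 1 * (d * e₀ ^ 2)) * ((4 + 4 * A) * ‖(fun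 j : Fin 2 => 2 * π / L * (v j : ℝ))‖ ^ 2) / klScale e₀ n₁) * 1 + 4 * (d * e₀ ^ 2 * 1 + 1 * (d * e₀ ^ 2)) * ((|2 * π / (L : ℝ)| * (4 + 2 * A)) + (4 + 4 * A) * (((klScale e₀ n₁ + B.smax * B.Dtmin * (3 * sectorWidth n₂ / 4)) / (B.Dtmin - 2 * A)) + 2 * ‖(fun j : Fin 2 => 2 * π / L * (v j : ℝ))‖) * ‖(fun j : Fin 2 => 2 * π / L * (v j : ℝ))‖) / klScale e₀ n₁ * (2 * Ba * (((1 + 2 * (sectorWidth n₁)⁻¹) * ‖momToComplex (fun j : Fin 2 => 2 * π / L * (v j : ℝ))‖) + ((1 + 2 * (sectorWidth n₂)⁻¹) * ‖momToComplex (fun j : Fin 2 => 2 * π / L * (v j : ℝ))‖))) + 1 * 1 * (2 * Ba * (((1 + 2 * (sectorWidth n₁)⁻¹) * ‖momToComplex (fun j : Fin 2 => 2 * π / L * (v j : ℝ))‖) ^ 2 + ((1 + 2 * (sectorWidth n₂)⁻¹) * ‖momToComplex (fun j : Fin 2 => 2 * π / L * (v j : ℝ))‖) ^ 2) + 8 *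 Ba ^ 2 * (((1 + 2 * (sectorWidth n₁)⁻¹) * ‖momToComplex (fun j : Fin 2 => 2 * π / L * (v j : ℝ))‖) * ((1 + 2 * (sectorWidth n₂)⁻¹) * ‖momToComplex (fun j : Fin 2 => 2 * π / L * (v j : ℝ))‖)))) :=
    fun q => norm_fwdDiff_two_space_klAnisoPair_le B hA hADt he hz hz1 hgap h3 hlo hhi hn ω₁ ω₂ hd.le hd1 hd2 hZ hΦ hGs hB0.le hB
      v huv hτv q
  -- sup and support
  have hsup := norm_klAnisoPair_le_one hA he hz h3 ω₁ ω₂ hZ hΦ hGs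
  have hNs := card_support_klAnisoPair_le B hA hADt he hz hz1 hgap h3 hlo hhi hβ hρA hn ω₁ ω₂ hd.le hd1 hd2 hZ hΦ hGs
  -- positivity of the constants
  have hKt : 0 < ((4 * (d * e₀ ^ 4 * 1 + 2 * (d * e₀ ^ 2) * (d * e₀ ^ 2) + 1 * (d * e₀ ^ 4)) + 2 * (d * e₀ ^ 2 * 1 + 1 * (d * e₀ ^ 2))) * (2 * π / β) ^ 2 * 1 / klScale e₀ n₁ ^ 2) := by positivity
  have hWv : 0 < ‖(fun j : Fin 2 => 2 * π / L * (v j : ℝ))‖ := lt_of_lt_of_le hc (norm_step_ge L hv)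
  have hvperp : (![-v 1, v 0] : Fin 2 → ℤ) ≠ 0 := by
    intro h
    apply hv
    have h0 : v 1 = 0 := by have := congr_fun h 0; simpa using this
    have h1 : v 0 = 0 := by have := congr_fun h 1; simpa using this
    funext j; fin_cases j <;> simp [h0, h1]
  have hWp : 0 < ‖(fun j : Fin 2 => 2 * π / L * (((![-v 1, v 0] : Fin 2 → ℤ) j : ℤ) : ℝ))‖ := lt_of_lt_of_le hc (norm_step_ge L hvperp)
  have hpos : ∀ (Wn Wm T0 : ℝ), 0 < Wn → 0 ≤ Wm → 0 ≤ T0 → 0 < (((4 * (d * e₀ ^ 4 * 1 + 2 * (d * e₀ ^ 2) * (d * e₀ ^ 2) + 1 * (d * e₀ ^ 4)) + 2 * (d * e₀ ^ 2 * 1 + 1 * (d * e₀ ^ 2))) * (T0 + (4 + 4 * A) * (((klScale e₀ n₁ + B.smax * B.Dtmin * (3 * sectorWidth n₂ / 4)) / (B.Dtmin - 2 * A)) + 2 * Wn) * Wn) ^ 2 / klScale e₀ n₁ ^ 2 + 2 * (d * e₀ ^ 2 * 1 + 1 * (d * e₀ ^ 2)) * ((4 + 4 * A) * Wn ^ 2)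 / klScale e₀ n₁) * 1 + 4 * (d * e₀ ^ 2 * 1 + 1 * (d * e₀ ^ 2)) * (T0 + (4 + 4 * A) * (((klScale e₀ n₁ + B.smax * B.Dtmin * (3 * sectorWidth n₂ / 4)) / (B.Dtmin - 2 * A)) + 2 * Wn) * Wn) / klScale e₀ n₁ * (2 * Ba * (((1 + 2 * (sectorWidth n₁)⁻¹) * Wm) + ((1 + 2 * (sectorWidth n₂)⁻¹) * Wm))) + 1 * 1 * (2 * Ba * (((1 + 2 * (sectorWidth n₁)⁻¹) * Wm) ^ 2 + ((1 + 2 * (sectorWidth n₂)⁻¹) * Wm) ^ 2) + 8 * Ba ^ 2 * (((1 + 2 * (sectorWidth n₁)⁻¹) * Wm) * ((1 + 2 * (sectorWidth n₂)⁻¹) * Wm)))) := by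
    intro Wn Wm T0 hWn hWm hT0
    have hD1 : 0 ≤ (1 + 2 * (sectorWidth n₁)⁻¹) * Wm := by positivity
    have hD2 : 0 ≤ (1 + 2 * (sectorWidth n₂)⁻¹) * Wm := by positivity
    have hτ : 0 ≤ T0 + (4 + 4 * A) * (((klScale e₀ n₁ + B.smax * B.Dtmin * (3 * sectorWidth n₂ / 4)) / (B.Dtmin - 2 * A)) + 2 * Wn) * Wn := by positivity
    have hmain : 0 < 2 * (d * e₀ ^ 2 * 1 + 1 * (d * e₀ ^ 2)) * ((4 + 4 * A) * Wn ^ 2) / klScale e₀ n₁ := by positivity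
    have t1 : 0 ≤ (4 * (d * e₀ ^ 4 * 1 + 2 * (d * e₀ ^ 2) * (d * e₀ ^ 2) + 1 * (d * e₀ ^ 4)) + 2 * (d * e₀ ^ 2 * 1 + 1 * (d * e₀ ^ 2))) * (T0 + (4 + 4 * A) * (((klScale e₀ n₁ + B.smax * B.Dtmin * (3 * sectorWidth n₂ / 4)) / (B.Dtmin - 2 * A)) + 2 * Wn) * Wn) ^ 2 / klScale e₀ n₁ ^ 2 := by positivity
    have t2 : 0 ≤ 4 * (d * e₀ ^ 2 * 1 + 1 * (d * e₀ ^ 2)) * (T0 + (4 + 4 * A) * (((klScale e₀ n₁ + B.smax * B.Dtmin * (3 * sectorWidth n₂ / 4)) / (B.Dtmin - 2 * A)) + 2 * Wn) * Wn) / klScale e₀ n₁ *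
        (2 * Ba * ((1 + 2 * (sectorWidth n₁)⁻¹) * Wm + (1 + 2 * (sectorWidth n₂)⁻¹) * Wm)) := by positivity
    have t3 : 0 ≤ 1 * 1 * (2 * Ba * (((1 + 2 * (sectorWidth n₁)⁻¹) * Wm) ^ 2 + ((1 + 2 * (sectorWidth n₂)⁻¹) * Wm) ^ 2) +
        8 * Ba ^ 2 * (((1 + 2 * (sectorWidth n₁)⁻¹) * Wm) * ((1 + 2 * (sectorWidth n₂)⁻¹) * Wm))) := by positivity
    have hx := add_pos_of_nonneg_of_pos t1 hmain
    linarith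
  have hK1 : 0 < (((4 * (d * e₀ ^ 4 * 1 + 2 * (d * e₀ ^ 2) * (d * e₀ ^ 2) + 1 * (d * e₀ ^ 4)) + 2 * (d * e₀ ^ 2 * 1 + 1 * (d * e₀ ^ 2))) * (((4 + 2 * A) * (2 * π / L)) + (4 + 4 * A) * (((klScale e₀ n₁ + B.smax * B.Dtmin * (3 * sectorWidth n₂ / 4)) / (B.Dtmin - 2 * A)) + 2 * (2 * π / L)) * (2 * π / L)) ^ 2 / klScale e₀ n₁ ^ 2 + 2 * (d * e₀ ^ 2 * 1 + 1 * (d * e₀ ^ 2)) * ((4 + 4 * A) * (2 * π / L) ^ 2) / klScale e₀ n₁) * 1 + 4 * (d * e₀ ^ 2 * 1 + 1 * (d * e₀ ^ 2)) * (((4 + 2 * A) * (2 * π / L)) + (4 + 4 * A) * (((klScale e₀ n₁ + B.smax * B.Dtmin * (3 * sectorWidth n₂ / 4)) / (B.Dtmin - 2 * A)) + 2 * (2 * π / L)) * (2 * π / L)) / klScale e₀ n₁ * (2 * Ba * (((1 + 2 * (sectorWidth n₁)⁻¹) * (2 * π / L)) + ((1 + 2 * (sectorWidth n₂)⁻¹)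 * (2 * π / L)))) + 1 * 1 * (2 * Ba * (((1 + 2 * (sectorWidth n₁)⁻¹) * (2 * π / L)) ^ 2 + ((1 + 2 * (sectorWidth n₂)⁻¹) * (2 * π / L)) ^ 2) + 8 * Ba ^ 2 * (((1 + 2 * (sectorWidth n₁)⁻¹) * (2 * π / L)) * ((1 + 2 * (sectorWidth n₂)⁻¹) * (2 * π / L))))) := hpos _ _ _ hc hc.le (by positivity)
  have hK2 : 0 < (((4 * (d * e₀ ^ 4 * 1 + 2 * (d * e₀ ^ 2) * (d * e₀ ^ 2) + 1 * (d * e₀ ^ 4)) + 2 * (d * e₀ ^ 2 * 1 + 1 * (d * e₀ ^ 2))) * (((4 + 2 * A) * ‖(fun j : Fin 2 => 2 * π / L * (((![-v 1, v 0] : Fin 2 → ℤ) j : ℤ) : ℝ))‖) + (4 + 4 * A) * (((klScale e₀ n₁ + B.smax * B.Dtmin * (3 * sectorWidth n₂ / 4)) / (B.Dtmin - 2 * A)) + 2 * ‖(fun j : Fin 2 => 2 * π / L * (((![-v 1, v 0] : Fin 2 → ℤ) j : ℤ) : ℝ))‖) * ‖(fun j : Fin 2 => 2 * π / L * (((![-v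 1, v 0] : Fin 2 → ℤ) j : ℤ) : ℝ))‖) ^ 2 / klScale e₀ n₁ ^ 2 + 2 * (d * e₀ ^ 2 * 1 + 1 * (d * e₀ ^ 2)) * ((4 + 4 * A) * ‖(fun j : Fin 2 => 2 * π / L * (((![-v 1, v 0] : Fin 2 → ℤ) j : ℤ) : ℝ))‖ ^ 2) / klScale e₀ n₁) * 1 + 4 * (d * e₀ ^ 2 * 1 + 1 * (d * e₀ ^ 2)) * (((4 + 2 * A) * ‖(fun j : Fin 2 => 2 * π / L * (((![-v 1, v 0] : Fin 2 → ℤ) j : ℤ) : ℝ))‖) + (4 + 4 * A) * (((klScale e₀ n₁ + B.smax * B.Dtmin * (3 * sectorWidth n₂ / 4)) / (B.Dtmin - 2 * A)) + 2 * ‖(fun j : Fin 2 => 2 * π / L * (((![-v 1, v 0] : Fin 2 → ℤ) j : ℤ) : ℝ))‖) * ‖(fun j : Fin 2 => 2 * π / L * (((![-v 1, v 0] : Fin 2 → ℤ) j : ℤ) : ℝ))‖) / klScale e₀ n₁ * (2 * Ba * (((1 + 2 * (sectorWidth n₁)⁻¹) * ‖momToComplex (fun j : Fin 2 => 2 * π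 / L * (((![-v 1, v 0] : Fin 2 → ℤ) j : ℤ) : ℝ))‖) + ((1 + 2 * (sectorWidth n₂)⁻¹) * ‖momToComplex (fun j : Fin 2 => 2 * π / L * (((![-v 1, v 0] : Fin 2 → ℤ) j : ℤ) : ℝ))‖))) + 1 * 1 * (2 * Ba * (((1 + 2 * (sectorWidth n₁)⁻¹) * ‖momToComplex (fun j : Fin 2 => 2 * π / L * (((![-v 1, v 0] : Fin 2 → ℤ) j : ℤ) : ℝ))‖) ^ 2 + ((1 + 2 * (sectorWidth n₂)⁻¹) * ‖momToComplex (fun j : Fin 2 => 2 * π / L * (((![-v 1, v 0] : Fin 2 → ℤ) j : ℤ) : ℝ))‖) ^ 2) + 8 * Ba ^ 2 * (((1 + 2 * (sectorWidth n₁)⁻¹) * ‖momToComplex (fun j : Fin 2 => 2 * π / L * (((![-v 1, v 0] : Fin 2 → ℤ) j : ℤ) : ℝ))‖) * ((1 + 2 * (sectorWidth n₂)⁻¹) * ‖momToComplex (fun j : Fin 2 => 2 * π / L * (((![-v 1, v 0] : Fin 2 → ℤ) j : ℤ) : ℝ))‖)))) := hpos _ _ _ hWp (norm_nonneg _) (by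 positivity)
  have hK3 : 0 < (((4 * (d * e₀ ^ 4 * 1 + 2 * (d * e₀ ^ 2) * (d * e₀ ^ 2) + 1 * (d * e₀ ^ 4)) + 2 * (d * e₀ ^ 2 * 1 + 1 * (d * e₀ ^ 2))) * ((|2 * π / (L : ℝ)| * (4 + 2 * A)) + (4 + 4 * A) * (((klScale e₀ n₁ + B.smax * B.Dtmin * (3 * sectorWidth n₂ / 4)) / (B.Dtmin - 2 * A)) + 2 * ‖(fun j : Fin 2 => 2 * π / L * (v j : ℝ))‖) * ‖(fun j : Fin 2 => 2 * π / L * (v j : ℝ))‖) ^ 2 / klScale e₀ n₁ ^ 2 + 2 * (d * e₀ ^ 2 * 1 + 1 * (d * e₀ ^ 2)) * ((4 + 4 * A) * ‖(fun j : Fin 2 => 2 * π / L * (v j : ℝ))‖ ^ 2) / klScale e₀ n₁) * 1 + 4 * (d * e₀ ^ 2 * 1 + 1 * (d * e₀ ^ 2)) * ((|2 * π / (L : ℝ)| * (4 + 2 * A)) + (4 + 4 * A) * (((klScale e₀ n₁ + B.smax * B.Dtmin * (3 * sectorWidth n₂ / 4)) / (B.Dtmin - 2 * A)) + 2 * ‖(fun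 j : Fin 2 => 2 * π / L * (v j : ℝ))‖) * ‖(fun j : Fin 2 => 2 * π / L * (v j : ℝ))‖) / klScale e₀ n₁ * (2 * Ba * (((1 + 2 * (sectorWidth n₁)⁻¹) * ‖momToComplex (fun j : Fin 2 => 2 * π / L * (v j : ℝ))‖) + ((1 + 2 * (sectorWidth n₂)⁻¹) * ‖momToComplex (fun j : Fin 2 => 2 * π / L * (v j : ℝ))‖))) + 1 * 1 * (2 * Ba * (((1 + 2 * (sectorWidth n₁)⁻¹) * ‖momToComplex (fun j : Fin 2 => 2 * π / L * (v j : ℝ))‖) ^ 2 + ((1 + 2 * (sectorWidth n₂)⁻¹) * ‖momToComplex (fun j : Fin 2 => 2 * π / L * (v j : ℝ))‖) ^ 2) + 8 * Ba ^ 2 * (((1 + 2 * (sectorWidth n₁)⁻¹) * ‖momToComplex (fun j : Fin 2 => 2 * π / L * (v j : ℝ))‖) * ((1 + 2 * (sectorWidth n₂)⁻¹) * ‖momToComplex (fun j : Fin 2 => 2 * π / L * (v j : ℝ))‖)))) := hpos _ _ _ hWv (norm_nonneg _) (by positivity)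
  -- the master lemma with the rates solved
  have main := sum_norm_charSum_le_of_consts Gs v hv hR₀ one_pos hKt hK1 hK2 hK3 (le_refl _) hsup h0 h1 h2 h3'
  refine main.trans ?_
  gcongr
end Main

end Summit.HubbardSuperconductivity.HubbardSuperconductivity.Theorems.TorusFourierL2

end
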